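import Summits.HodgeConjecture.HodgeConjecture.Theorems.PadicSemiregularLiftFormalVectorBundlesAlgebraizeChowCoverNormal
import Summits.HodgeConjecture.HodgeConjecture.Theorems.PadicSemiregularLiftFormalVectorBundlesAlgebraizeThickenings
import Summits.HodgeConjecture.HodgeConjecture.Theorems.PadicSemiregularLiftFormalVectorBundlesAlgebraizePushforwardComparison
import Summits.HodgeConjecture.HodgeConjecture.Theorems.PadicSemiregularLiftFormalVectorBundlesAlgebraizeUnitComparisonStructureSheaf
import Summits.HodgeConjecture.HodgeConjecture.Theorems.PadicSemiregularLiftFormalVectorBundlesAlgebraizeUnitComparison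
import Literature.AlgebraicGeometry.Morphisms.FormalModuleIsogenyRoofTorsion
import Literature.AlgebraicGeometry.Morphisms.FormalModulePowerTorsion
import Literature.AlgebraicGeometry.Morphisms.FormalModuleProjective
import Literature.AlgebraicGeometry.Morphisms.FormalModulePullback
import Literature.AlgebraicGeometry.Morphisms.CechH1Pullback
import Literature.AlgebraicGeometry.Morphisms.ProperPushforwardCoh
import Literature.AlgebraicGeometry.Motives.GrothendieckExistenceWittProjective
import Literature.AlgebraicGeometry.Modules.VectorBundleFiniteLocallyFree

/-!
# `PadicSemiregularLift.FormalVectorBundlesAlgebraize` (stmt-HodgeConjecture-14106), proved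

**Grothendieck's existence theorem for vector bundles on a smooth PROPER `W(k)`-scheme** (`k` perfect
of characteristic `p`): every compatible system of vector bundles on the thickenings
`X_{n+1} = 𝒳 ⊗_W W/pⁿ⁺¹` is the system of restrictions of a vector bundle on `𝒳`
(`exists_isVectorBundle_forall_pullback_thickeningι_iso`), whence the route item
`LiftsFormally 𝒳 E₁ → LiftsTo 𝒳 E₁` for smooth proper models
(`padicSemiregularLift_formalVectorBundlesAlgebraize_proof`; the projective case is
`Motives.formalVectorBundlesAlgebraize_of_isProjectiveOverRing`).

Proof (GW II 24.104–24.106 / Stacks 088B–088C along `𝒥 = (p)`, with Chow's lemma replaced by the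
Chow cover with `ρ_*𝒪 = 𝒪` of `…AlgebraizeChowCoverNormal`). Let `𝓕 = (ι_{n+1*}E_n)_n` be the formal tower
of coherent `𝒪_𝒳`-modules of the system (`Motives/GrothendieckExistenceWittReduction`) and
`ρ : 𝒳' → 𝒳` the Chow cover: `𝒳'` projective over `W`, `ρ` proper, `ρ♯` bijective on all opens.
* `ρ^*𝓕` is a formal tower of coherent modules on the projective `𝒳'`, hence `≅ (𝒢'/pⁿ⁺¹)_n` for a
  coherent `𝒢'` (`Morphisms.exists_coh_iso_cmplTower_of_isClosedImmersion_PP`, GW II Lemma 24.103);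
* the ROOF `𝓕 —u→ ρ_*ρ^*𝓕 ≅ ρ_*(𝒢'/pⁿ⁺¹) ←v— (ρ_*𝒢')/pⁿ⁺¹`: `v` has kernel and cokernel killed by a
  fixed power of `p` (theorem on formal functions for `ρ`, `…AlgebraizePushforwardComparison`), and so
  has the unit `u` (for `𝒪/pⁿ⁺¹` because `ρ_*𝒪_{𝒳'} = 𝒪_𝒳`, `…AlgebraizeUnitComparisonStructureSheaf`; for
  `ι_{n+1*}E_n`, locally `≅ (𝒪/pⁿ⁺¹)^k`, by `…AlgebraizeUnitComparison`); the roof therefore yields a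
  morphism of towers `α : 𝓕 → ((ρ_*𝒢')/pⁿ⁺¹)_n` with kernels and cokernels killed by a fixed power of
  `p` (`Morphisms.exists_towerHom_of_powTorsion_roof_of_torsion`);
* the "tricky lemma" along `(p)` (`Morphisms.exists_coh_iso_cmplTower_of_powTorsion_comparison`,
  Stacks 088A): `𝓕 ≅ (F/pⁿ⁺¹F)_n` for a coherent `F`, which is then a vector bundle with
  `ι_{n+1}^*F ≅ E_n` (`WittScheme.isVectorBundle_and_iso_of_cokernelIsos`, `pullbackThickeningιIso`).

Everything is proved; no named-fact hypothesis.
-/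

set_option linter.dupNamespace false

noncomputable section

-- Summit.HodgeConjecture.HodgeConjecture.… repeats the summit name by the D-0017 layout (Sub = Summit).

-- `TopCat.Presheaf`/`Scheme.Modules` are not reducible (as in Mathlib's `AlgebraicGeometry/Modules`).
set_option backward.isDefEq.respectTransparency false

open CategoryTheory CategoryTheory.Limits AlgebraicGeometry TopologicalSpace Opposite
open Literature.AlgebraicGeometry.Modules Literature.AlgebraicGeometry.Morphisms
open Literature.AlgebraicGeometry.Morphisms.ProjCech
open Literature.AlgebraicGeometry.Motives Literature.AlgebraicGeometry.Motives.WittScheme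
open Literature.AlgebraicGeometry.Resolution

universe u

namespace Summit.HodgeConjecture.HodgeConjecture.Theorems

namespace FormalVectorBundlesAlgebraize

/-! ### Weakening the exponent of an `a`-power bound -/

section Pow

variable {X : Scheme.{u}} (b : Γ(X, ⊤)) {A B : X.Modules} (v : A ⟶ B)

/-- A kernel killed by `b^c` is killed by `b^d`, `c ≤ d`. -/
theorem kernel_ι_pow_of_le {c d : ℕ} (h : c ≤ d) (hk : kernel.ι v ≫ globalScalar A (b ^ c) = 0) :
    kernel.ι v ≫ globalScalar A (b ^ d) = 0 := by
  obtain ⟨e, rfl⟩ := Nat.exists_eq_add_of_le h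
  rw [add_comm, pow_add, globalScalar_mul, ← Category.assoc, hk, zero_comp]

/-- A cokernel killed by `b^c` is killed by `b^d`, `c ≤ d`. -/
theorem pow_cokernel_π_of_le {c d : ℕ} (h : c ≤ d) (hc : globalScalar B (b ^ c) ≫ cokernel.π v = 0) :
    globalScalar B (b ^ d) ≫ cokernel.π v = 0 := by
  obtain ⟨e, rfl⟩ := Nat.exists_eq_add_of_le h
  rw [pow_add, globalScalar_mul, Category.assoc, hc, comp_zero]

end Pow

/-! ### The roof over a projective Chow cover -/

section Roof

variable {A : Type u} [CommRing A] [IsNoetherianRing A] {X X' : Scheme.{u}} (f : X ⟶ Spec (.of A))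
  [IsProper f] (a₀ : A) [IsAdicComplete (Ideal.span {a₀}) A] [IsLocallyNoetherian X] [CompactSpace X]
  (ρ : X' ⟶ X) [IsProper ρ] {r : ℕ} (ι₀ : X' ⟶ PP A r) [IsClosedImmersion ι₀] (hw : ρ ≫ f = strZ ι₀)

include hw in
/-- **Algebraization through the roof over a projective cover.** Let `X → Spec A` be proper, `A`
noetherian and `a₀`-adically complete, `ρ : X' → X` proper with `X'` a closed subscheme of `ℙʳ_A`
(over `A`), and `𝓕` a formal tower of coherent `𝒪_X`-modules along `a = a₀·1`. If the units
`𝓕_n → ρ_*ρ^*𝓕_n` have kernels killed by `a^c₁` and cokernels killed by `a^c₂` for all `n`, then `𝓕` is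
the completion tower of a coherent `𝒪_X`-module. -/
theorem exists_coh_iso_cmplTower_of_unit_torsion {𝓕 : ℕᵒᵖ ⥤ X.Modules}
    (hT : IsFormalTower (algebraMapΓ f a₀) 𝓕) (hTc : ∀ n, Coh (𝓕.obj ⟨n⟩)) {c₁ c₂ : ℕ}
    (huk : ∀ n : ℕᵒᵖ, kernel.ι ((Scheme.Modules.pullbackPushforwardAdjunction ρ).unit.app (𝓕.obj n)) ≫
      globalScalar (𝓕.obj n) (algebraMapΓ f a₀ ^ c₁) = 0)
    (huc : ∀ n : ℕᵒᵖ, globalScalar ((Scheme.Modules.pullback ρ ⋙ Scheme.Modules.pushforward ρ).obj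
        (𝓕.obj n)) (algebraMapΓ f a₀ ^ c₂) ≫
      cokernel.π ((Scheme.Modules.pullbackPushforwardAdjunction ρ).unit.app (𝓕.obj n)) = 0) :
    ∃ F : X.Modules, Coh F ∧ Nonempty (𝓕 ≅ cmplTower (algebraMapΓ f a₀) F) := by
  haveI : IsLocallyNoetherian X' := isLocallyNoetherian_of_isClosedImmersion_PP ι₀
  haveI : CompactSpace X' := compactSpace_of_isClosedImmersion_PP ι₀
  let a : Γ(X, ⊤) := algebraMapΓ f a₀
  let η := (Scheme.Modules.pullbackPushforwardAdjunction ρ).unit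
  have ha' : ρ.appTop a = algebraMapΓ (strZ ι₀) a₀ := Sections.appTop_algebraMapΓ f (strZ ι₀) ρ hw a₀
  -- the inverse image tower on the projective `X'` is a completion tower
  have hT' : IsFormalTower (algebraMapΓ (strZ ι₀) a₀) (𝓕 ⋙ Scheme.Modules.pullback ρ) := by
    rw [← ha']; exact IsFormalTower.comp_pullback ρ a hT
  have hT'c : ∀ n, Coh ((𝓕 ⋙ Scheme.Modules.pullback ρ).obj ⟨n⟩) := fun n => coh_comp_pullback ρ hTc n
  obtain ⟨G', hG', ⟨e⟩⟩ : ∃ G' : X'.Modules, Coh G' ∧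
      Nonempty (𝓕 ⋙ Scheme.Modules.pullback ρ ≅ cmplTower (ρ.appTop a) G') := by
    rw [ha']; exact exists_coh_iso_cmplTower_of_isClosedImmersion_PP a₀ ι₀ hT' hT'c
  -- `H = ρ_*G'` and the comparison `v : H^ → ρ_*(G'^)`
  let H : X.Modules := (Scheme.Modules.pushforward ρ).obj G'
  have hH : Coh H := coh_pushforward_of_isProper ρ hG'
  obtain ⟨v, hv⟩ := exists_pushforwardCmplComparison ρ a G'
  obtain ⟨ck, hck⟩ := pushforwardCmplComparison_kernel_torsion ρ a hG' v hv
  obtain ⟨cc, hcc⟩ := pushforwardCmplComparison_cokernel_torsion ρ a hG' v hv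
  -- the roof `𝓕 —u→ P := ρ_*ρ^*𝓕 ←v'— H^`
  let P : ℕᵒᵖ ⥤ X.Modules := (𝓕 ⋙ Scheme.Modules.pullback ρ) ⋙ Scheme.Modules.pushforward ρ
  let u : 𝓕 ⟶ P :=
    { app := fun n => η.app (𝓕.obj n)
      naturality := fun _ _ g => η.naturality (𝓕.map g) }
  let v' : cmplTower a H ⟶ P := v ≫ Functor.whiskerRight e.inv (Scheme.Modules.pushforward ρ)
  have hv'app : ∀ n, v'.app n = v.app n ≫ (Scheme.Modules.pushforward ρ).map (e.inv.app n) :=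
    fun n => rfl
  -- uniform bounds, common exponent `c = ck + cc`
  let ε : ∀ T : X.Modules, T ⟶ T := fun T => globalScalar T (a ^ (ck + cc))
  have hε : ∀ {T T' : X.Modules} (g : T ⟶ T'), ε T ≫ g = g ≫ ε T' := fun g => globalScalar_comp g _
  have hvk : ∀ n : ℕᵒᵖ, kernel.ι (v'.app n) ≫ globalScalar ((cmplTower a H).obj n) (a ^ (ck + cc)) = 0 := by
    intro n
    refine kernel_ι_of_kerBound (a ^ (ck + cc)) (v'.app n) fun z hz => ?_
    rw [hv'app] at hz
    exact kerBound_comp_mono ε (v.app n) _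
      (kerBound_of_kernel_ι (a ^ (ck + cc)) (v.app n)
        (kernel_ι_pow_of_le a (v.app n) (Nat.le_add_right ck cc) (hck n.unop))) z hz
  have hvc : ∀ n : ℕᵒᵖ, globalScalar (P.obj n) (a ^ (ck + cc)) ≫ cokernel.π (v'.app n) = 0 := by
    intro n
    refine cokernel_π_of_cokerBound (a ^ (ck + cc)) (v'.app n) fun q hq => ?_
    rw [hv'app] at hq
    exact cokerBound_comp_epi ε hε (v.app n) _
      (cokerBound_of_cokernel_π (a ^ (ck + cc)) (v.app n)
        (pow_cokernel_π_of_le a (v.app n) (Nat.le_add_left cc ck) (hcc n.unop))) q hq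
  -- the roof gives `α : 𝓕 → H^` with `a`-power torsion kernel and cokernel
  obtain ⟨α, hα⟩ := exists_towerHom_of_powTorsion_roof_of_torsion a u v' huk huc hvk hvc
  -- the tricky lemma along `(a)`
  let d : ℕ := ck + cc + (ck + cc) + (c₁ + c₂)
  exact exists_coh_iso_cmplTower_of_powTorsion_comparison f a₀ hT hTc hH α (d := d)
    (fun n => kernel_ι_pow_of_le a _ (by omega) (hα ⟨n⟩).1)
    (fun n => pow_cokernel_π_of_le a _ (by omega) (hα ⟨n⟩).2)

end Roof

/-! ### Grothendieck's existence theorem for vector bundles on a smooth proper model -/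

section Witt

variable {p : ℕ} [Fact p.Prime] {k : Type} [Field k] [CharP k p] [PerfectRing k p]

/-- **Grothendieck's existence theorem for vector bundles on a smooth proper `W(k)`-scheme** (GW II
Thm. 24.94 with Prop. 24.95, general proper case), `k` perfect of characteristic `p`: for a smooth
proper model `𝒳 / W(k)` and vector bundles `E_n` on the thickenings `X_{n+1} = 𝒳 ⊗ W/pⁿ⁺¹` with
`E_{n+1}|_{X_{n+1}} ≅ E_n`, there is a vector bundle `F` on `𝒳` with `F|_{X_{n+1}} ≅ E_n` for all `n`. -/
theorem exists_isVectorBundle_forall_pullback_thickeningι_iso {d : ℕ}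
    (𝒳 : SchemeOver (WittVector p k)) (h𝒳 : IsSmoothProperModel d 𝒳)
    (E : ∀ n : ℕ, (thickening 𝒳 (n + 1)).left.Modules) (hE : ∀ n, IsVectorBundle (E n))
    (hcompat : ∀ n, Nonempty ((Scheme.Modules.pullback
      (thickeningMap 𝒳 (Nat.le_succ (n + 1)))).obj (E (n + 1)) ≅ E n)) :
    ∃ F : 𝒳.left.Modules, IsVectorBundle F ∧
      ∀ n : ℕ, Nonempty ((Scheme.Modules.pullback (thickeningι 𝒳 (n + 1))).obj F ≅ E n) := by
  -- the Chow cover `ρ : 𝒳' → 𝒳`: `𝒳'` projective over `W`, `ρ` proper, `ρ♯` bijective on all opens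
  obtain ⟨𝒳', ρ, -, ⟨r, ι', hι'⟩, -, hρ, hρiso⟩ := stub_chowCoverNormal p k d 𝒳 h𝒳
  let ι₀ : 𝒳'.left ⟶ PP (WittVector p k) r := ι'.left
  haveI : IsClosedImmersion ι₀ := hι'
  haveI : IsProper 𝒳.hom := h𝒳.isProper
  haveI : IsProper ρ.left := hρ
  haveI : IsLocallyNoetherian 𝒳.left := ⟨fun U => isNoetherianRing_sections 𝒳 U.2⟩
  haveI : CompactSpace 𝒳.left := compactSpace_left 𝒳
  have hw : ρ.left ≫ 𝒳.hom = strZ ι₀ := (Over.w ρ).trans (Over.w ι').symm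
  have hρbij : ∀ U : 𝒳.left.Opens, Function.Bijective (ρ.left.app U) := fun U => by
    haveI := hρiso U
    exact ConcreteCategory.bijective_of_isIso (ρ.left.app U)
  -- the direct-image tower `M_n = ι_{n+1*} E_n` along `a = p·1`
  obtain ⟨hcoh, hkill, htrans⟩ := coh_tower_of_formalVectorBundle 𝒳 E hE hcompat
  have hpow : ∀ m, algebraMapΓ 𝒳.hom ((p : WittVector p k) ^ m) =
      algebraMapΓ 𝒳.hom (p : WittVector p k) ^ m := algebraMapΓ_pow 𝒳
  let a : Γ(𝒳.left, ⊤) := algebraMapΓ 𝒳.hom (p : WittVector p k)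
  have hapow : ∀ m, a ^ m = ((p ^ m : ℕ) : Γ(𝒳.left, ⊤)) := fun m => by
    rw [Nat.cast_pow, ← map_natCast (algebraMapΓ 𝒳.hom) p]
  let M : ℕ → 𝒳.left.Modules := fun n =>
    (Scheme.Modules.pushforward (thickeningι 𝒳 (n + 1))).obj (E n)
  let β : ∀ n, cokernel (globalScalar (M (n + 1)) (a ^ (n + 1))) ≅ M n := fun n =>
    cokernelIsoOfEq (by rw [hpow]) ≪≫ (htrans n).some
  have hk' : ∀ n, globalScalar (M n) (a ^ (n + 1)) = 0 := fun n => by rw [← hpow]; exact hkill n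
  have hT : IsFormalTower a (towerOfIsos a M β) := IsFormalTower.ofIsos _ M β hk'
  have hTc : ∀ n, Coh ((towerOfIsos a M β).obj ⟨n⟩) := fun n => hcoh n
  -- the units `M_n → ρ_*ρ^*M_n` are `a`-power isogenies, uniformly in `n`
  obtain ⟨c₁, c₂, hQ⟩ := exists_unit_cmplObj_unit_torsion ρ.left a hρbij
  have hcut : ∀ (n : ℕ) (W : 𝒳.left.Opens), IsAffineOpen W →
      Function.Surjective ((thickeningι 𝒳 (n + 1)).app W) ∧
        ∀ r : Γ(𝒳.left, W), (thickeningι 𝒳 (n + 1)).app W r = 0 ↔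
          ∃ c : Γ(𝒳.left, W), r = 𝒳.left.presheaf.map (homOfLE (le_top : W ≤ ⊤)).op
            (a ^ (n + 1)) * c := fun n W hW => by
    rw [hapow]; exact thickeningι_cutOut 𝒳 (n + 1) hW
  have happ : ∀ n : ℕ, (thickeningι 𝒳 (n + 1)).appTop (a ^ (n + 1)) = 0 := fun n => by
    rw [hapow]; exact thickeningι_app_top_natCast_pow 𝒳 (n + 1)
  have hu : ∀ n : ℕ,
      kernel.ι ((Scheme.Modules.pullbackPushforwardAdjunction ρ.left).unit.app (M n)) ≫
          globalScalar (M n) (a ^ c₁) = 0 ∧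
        globalScalar ((Scheme.Modules.pullback ρ.left ⋙ Scheme.Modules.pushforward ρ.left).obj (M n))
          (a ^ c₂) ≫
          cokernel.π ((Scheme.Modules.pullbackPushforwardAdjunction ρ.left).unit.app (M n)) = 0 :=
    fun n => by
      haveI := isClosedImmersion_thickeningι 𝒳 (n + 1)
      exact unit_pushforward_torsion ρ.left (thickeningι 𝒳 (n + 1)) a n (hcut n) (happ n)
        (isFiniteLocallyFree_of_isVectorBundle (hE n)) (hQ n).1 (hQ n).2
  -- algebraize the tower through the roof over `𝒳'`
  obtain ⟨F, hF, ⟨eF⟩⟩ := exists_coh_iso_cmplTower_of_unit_torsion 𝒳.hom (p : WittVector p k)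
    ρ.left ι₀ hw hT hTc (fun n => (hu n.unop).1) (fun n => (hu n.unop).2)
  have hFfp : SheafOfModules.IsFinitePresentation F := isFinitePresentation_of_coh F hF
  -- levelwise `F/pⁿ⁺¹F ≅ ι_{n+1*} E_n`, and back to the restriction model
  have β' : ∀ n, cokernel (globalScalar F (algebraMapΓ 𝒳.hom ((p : WittVector p k) ^ (n + 1)))) ≅
      (Scheme.Modules.pushforward (thickeningι 𝒳 (n + 1))).obj (E n) := fun n =>
    cokernelIsoOfEq (by rw [hpow]) ≪≫ (eF.app ⟨n⟩).symm
  obtain ⟨hFvb, -⟩ := isVectorBundle_and_iso_of_cokernelIsos 𝒳 E hE F hFfp β'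
  exact ⟨F, hFvb, fun n => ⟨pullbackThickeningιIso (n + 1) F (β' n)⟩⟩

/-- **`LiftsFormally ⟹ LiftsTo` on a smooth proper model** (Bloch–Esnault–Kerz 2014, §1 (1.3), at the
level of vector bundles): a module on the special fibre which lifts to a compatible system of vector
bundles on all thickenings is the restriction of a vector bundle on `𝒳`. -/
theorem liftsTo_of_liftsFormally {d : ℕ} {𝒳 : SchemeOver (WittVector p k)}
    (h𝒳 : IsSmoothProperModel d 𝒳) {E₁ : (specialFibre 𝒳).left.Modules}
    (hE : LiftsFormally 𝒳 E₁) : LiftsTo 𝒳 E₁ := by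
  obtain ⟨E, hEvb, hstep, ⟨e0⟩⟩ := hE
  obtain ⟨F, hF, e⟩ := exists_isVectorBundle_forall_pullback_thickeningι_iso 𝒳 h𝒳 E hEvb hstep
  obtain ⟨e1⟩ := e 0
  refine ⟨F, hF, ⟨?_⟩⟩
  exact (Scheme.Modules.pullbackCongr (specialFibreToThickening_ι 𝒳 0).symm).app F ≪≫
    (Scheme.Modules.pullbackComp (specialFibreToThickening 𝒳 0) (thickeningι 𝒳 1)).symm.app F ≪≫
    (Scheme.Modules.pullback (specialFibreToThickening 𝒳 0)).mapIso e1 ≪≫ e0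

end Witt

end FormalVectorBundlesAlgebraize

/-- **Route item stmt-HodgeConjecture-14106, `PadicSemiregularLift.FormalVectorBundlesAlgebraize`**:
for a smooth proper model `𝒳 / W(k)` (`k` perfect of characteristic `p`), every module on the special
fibre which lifts formally (to a compatible system of vector bundles on all `𝒳 ⊗ W/pⁿ⁺¹`) lifts to a
vector bundle on `𝒳` — Grothendieck's existence theorem for vector bundles in the proper case. -/
theorem padicSemiregularLift_formalVectorBundlesAlgebraize_proof :
    Summit.HodgeConjecture.HodgeConjecture.Theses.PadicSemiregularLift.FormalVectorBundlesAlgebraize :=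
  fun _ _ _ _ _ _ _ _ h𝒳 _ hE => FormalVectorBundlesAlgebraize.liftsTo_of_liftsFormally h𝒳 hE

end Summit.HodgeConjecture.HodgeConjecture.Theorems

end
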